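import Mathlib
import HarnessLib
import HarnessLib.Audit
import Summits.MatrixMultiplication.Statement
import Literature.Computability.AlgebraicComplexity.MatrixMultiplicationExponent
import Literature.Computability.AlgebraicComplexity.SchoenhageTau
import Literature.Computability.AlgebraicComplexity.AsymptoticSpectrum
import Literature.Computability.AlgebraicComplexity.SchoenhageTauDischarge
import HarnessLib.Audit.Status.Attr

/-!
Route: TropicalBiniPatterns

DORMANT since 2026-08-23T11:32:11Z (reconciler: no traction for 6.1 d (last activity statement-grounded at 2026-08-17T08:42:09Z); parked, not closed — `ledger route dormant route-MatrixMultiplication-TropicalBiniPatterns --off` to react) — unstaffed, not closed; items shared with open routes are served there. `ledger route dormant <id> --off` reactivates.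

# Route TropicalBiniPatterns — tropical Brent prevariety — border identities for direct sums of
matrix products as enumerable Bini patterns, read through Schönhage's τ-theorem

It suffices to show X = BORDER CERTIFICATE FAMILY (realises card tropical-brent-bini-patterns, an
ENGINE card): for every ε > 0
there is a finite direct sum D = ⊕_{i<p} ⟨k_i,m_i,n_i⟩ of matrix products (p ≥ 1, every block of
volume k_i m_i n_i ≥ 2) and an r
with bR(D) ≤ r ≤ Σ_i (k_i m_i n_i)^{(2+ε)/3}, bR = the algebraic border rank over ℂ[ε] (Bläser 2013
Def. 6.1, `algBorderRank`). By
Schönhage's τ-theorem (PROVED in the tree: `asymptoticSumInequality_algBorderRank`) X gives ω(ℂ) ≤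
2+ε for all ε, and ω ≥ 2 is
`two_le_omega`; conversely ω = 2 gives X with p = 1, so X is an honest reformulation and the content
of the line is HOW border
identities are found: a border identity of order h is a lattice point W (the ε-valuation pattern of
its 3r vectors) of the
TROPICAL BRENT PREVARIETY of T — Kapranov's "minimum attained twice" conditions relative to the
constant tensor (support item
TropicalBrentNecessary) — whose INITIAL SYSTEM (Brent equations truncated to the min-attaining
terms; mostly binomial) is
solvable and LIFTS ε-adically; patterns live in a quotient lattice modulo the isotropy torus, term
rescalings, S_r and the
finite isotropy, a finite enumerable set per (T, r, h). The ranked cruxes are the finite cells the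
enumerator attacks first.
Lean: `∀ ε : ℝ, 0 < ε → ∃ (p : ℕ) (k m n : Fin p → ℕ) (r : ℕ), 0 < p ∧ (∀ i, 2 ≤ k i * m i * n i) ∧
Literature.Computability.AlgebraicComplexity.algBorderRank
(Literature.Computability.AlgebraicComplexity.matMulDirectSum ℂ k m n) ≤ r ∧ (r : ℝ) ≤ ∑ i, ((k i *
m i * n i : ℕ) : ℝ) ^ ((2 + ε) / 3)`

## Assembly
Real-analysis bookkeeping only (checked sorry-free in the folder Sketch.lean as `assembly_sketch`,
from `two_le_omega`): given ε > 0,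
X supplies D = ⊕⟨k_i,m_i,n_i⟩ and r with bR(D) ≤ r ≤ Σ (k_i m_i n_i)^{(2+ε)/3}; the PROVED
border-rank ASI
`asymptoticSumInequality_algBorderRank` gives Σ (k_i m_i n_i)^{ω/3} ≤ r; every block has volume ≥ 2
and p ≥ 1, so ω > 2+ε would make
the left sum strictly larger (`Real.rpow_lt_rpow_of_exponent_lt`, `Finset.sum_lt_sum_of_nonempty`) —
hence ω ≤ 2+ε for all ε, and with
`two_le_omega` (Theorems/AsymptoticSpectrumOmegaGeTwo) ω(ℂ) = 2. The ranked cruxes are rungs of the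
engine (finite X-instances and
client cells), not premises of the Assembly — the accepted shape of an engine route (cf.
BrentRefutationDepth).

Rationale: WHY THIS LINE. Every border identity in print was found PATTERN-FIRST by hand — Bini 1980
(doi:10.1007/BF02575865), Schönhage's ⟨e,1,ℓ⟩ ⊕ ⟨1,(e−1)(ℓ−1),1⟩ ≤_3 ⟨eℓ+1⟩
(Schonhage1981; BCS 1997 (15.12), proof p.422: "cancellation of the constant and of all terms linear
in ε"), Coppersmith–Winograd's
identities (CoppersmithWinograd1990; BCS Ex. 15.17), bR(⟨3,3,3⟩) ≤ 21 (BCS Ex. 15.8) — or by a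
uniform low-degree ansatz plus numerics
(Smirnov2013's 20 for ⟨3,3,3⟩; ConnerGesmundoLandsbergVentura2022 p.17 read an ε-exponent pattern
off an SVD before re-solving exactly);
exact-rank search has been industrialised (SAT, flip graphs, KauersMoosbauerWood2026 =
arXiv:2602.11041) while border-rank search has no
discrete skeleton. The import is TROPICAL ALGEBRAIC GEOMETRY (Kapranov's theorem, prevarieties,
initial ideals and lifting,
doi:10.1090/gsm/161; tropical secant DIMENSIONS, Draisma doi:10.1016/j.jpaa.2007.05.022) pointed at
MEMBERSHIP of one tensor in σ_r over
ℂ[[ε]]: the valuation pattern is the skeleton, Strassen's combinatorial degenerations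
(doi:10.1515/crll.1987.375-376.406; BCS Def.
15.29–15.30) are its diagonal special case, and the isotropy-lattice quotient makes patterns finite
per pole order, so "guess the
exponents" becomes "enumerate, filter by the initial system over 𝔽_p/ℚ, lift, certify over ℚ[ε]" —
every success a kernel-checkable
polynomial identity (`IsApproxDecomposition`), every exhaustion at order h a new kind of negative
datum. What it adds to existing routes:
BrentRefutationDepth certifies NON-existence (NS/SOS, lower bounds) — this is the complementary
existence back-end; StrassenDefect,
CatalyticDegeneration, AsymptoticRankCW and six open cards pose finite border-rank cells with no
search method (this route shares
AsymptoticRankCW's stmt-MatrixMultiplication-1852 verbatim as a client); negatives index empty at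
filing.

RANKED CRUXES. #0 BorderCertificateFamily (target) — X as in § Thesis: ∀ε>0 ∃ p ≥ 1, blocks
⟨k_i,m_i,n_i⟩ (all k_i m_i n_i ≥ 2) and r with bR(⊕_i ⟨k_i,m_i,n_i⟩) ≤ r ≤ Σ_i (k_i m_i
n_i)^{(2+ε)/3} over ℂ. (why it might fail: Equivalent to ω(ℂ)=2, so false if any refutation line
(BorderRankLowerBound, BrentRefutationDepth, FidelityWitnesses) succeeds; and by CW82 strict ASI no
single certificate reaches τ = 2/3, so an INFINITE parametric family of patterns is needed and none
beyond laser-type degenerations is known.) [Schonhage1981, Blaser2013, CoppersmithWinograd1982,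
doi:10.1007/978-3-662-03338-8]
#2 TwoSquaresThirteen (crux) — bR(⟨2,2,2⟩ ⊕ ⟨2,2,2⟩) ≤ 13 over ℂ[ε] (card C1, the auditor's "right
first run"; format 8×8×8, r = 13): two independent 2×2 products share a border saving. Window
[12,14]: 14 = Strassen ⊕ Strassen, 12 = Koszul flattening via the module restriction ⟨2,2,4⟩ ≤
2⊙⟨2,2,2⟩ (LandsbergOttaviani2015 Cor 1.2; recomputed this session: p=1 gives 12, p=2,3 give 11). An
X-instance with ε = 0.70 (2·8^τ = 13, ω ≤ 2.70) and the smallest cell of border (non-)additivity for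
identical matrix-product blocks (card independent-products-amortised-rank Q_b). Engine: patterns of
order h ≤ 3 modulo (G_{M_2}² ⋊ S_2)-isotropy lattice × S_13. [difficulty: L] (why it might fail: bR
is probably 14 (border additivity for two identical ⟨2,2,2⟩ blocks; ALS at r = 13 finds only the
drop-one-term plateau, card independent-products-amortised-rank); Schönhage-type savings use unequal
rectangular shapes; and a 13 might need pole order beyond the enumerable range.) [Schonhage1981,
LandsbergOttaviani2015, arXiv:1902.06582, arXiv:1504.03732, CoppersmithWinograd1982, Landsberg2005]
#3 KissingBeyondSchonhage (crux) — KISSING BEYOND SCHÖNHAGE: for some k, n ≥ 2 one more free scalar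
product fits, bR(⟨k,1,n⟩ ⊕ ⟨1,(k−1)(n−1)+1,1⟩) ≤ kn + 1 (then = kn+1 by conciseness). Schönhage's
(15.12) gives m = (k−1)(n−1) at order ≤_3; the flattening ceiling is m ≤ kn + 1 − max(k,n); Koszul
flattenings (p ≤ 3, generic restriction, this session: compute/koszul_kiss.py) kill m = (k−1)(n−1)+2
and are BLIND at +1 for (k,n) ∈ {(2,2),(2,3),(3,3)} — cells 5×4×4 r=5, 7×5×6 r=7, 10×8×8 r=10, the
engine's native family and cheapest virgin territory (Schönhage found his pattern by hand). Each
positive cell is a new X-instance ((2,2): 4^τ + 2^τ = 5, τ = 0.842, ω ≤ 2.53 from a 5×4×4 tensor); a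
parametric positive answer is a new certificate FAMILY. [difficulty: M] (why it might fail:
(k−1)(n−1) may be optimal for every (k,n): at (2,2) the lowest-order pattern (identity block at ε²)
is already impossible by a row-space argument (NOTES), and minimal-border-rank rigidity (Strassen's
equations, arXiv:2205.05713) may give a uniform kn+2 lower bound.) [Schonhage1981,
doi:10.1007/978-3-662-03338-8, Blaser2013, LandsbergOttaviani2015, arXiv:2205.05713,
arXiv:1902.06582]
#4 ThreeByThreeNineteen (crux) — bR(⟨3,3,3⟩) ≤ 19 over ℂ[ε] (card C2; format 9×9×9). Window [17,20]:
17 by border apolarity (ConnerHarperLandsberg2023), 20 by Smirnov2013 (numerical then exact), 21 =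
Schönhage's order-2 pattern (BCS Ex. 15.8). Engine: patterns of order h ≤ 2 with a stabiliser of
order ≥ 3 in (S_3 ≀ transpose/cyclic) × torus — the border analogue of the symmetric-scheme
searches; a 19 reads ω ≤ log_27 19³ = 2.68 and is the first movement at 3×3 since 2013. [deps:
TwoSquaresThirteen] [difficulty: open-problem] (why it might fail: bR(⟨3,3,3⟩) may be 20: a decade
of numerical searches (Smirnov) found 20 repeatedly and never 19; border apolarity may climb from
17; and a 19 of order > 2 or with trivial stabiliser is invisible to the restricted enumeration.)
[Smirnov2013, ConnerHarperLandsberg2023, doi:10.1007/978-3-662-03338-8, LandsbergMichalek2018,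
BuczynskaBuczynski2021]
#5 CwCubeSixtyThree (crux) — SHARED CLIENT (verbatim AsymptoticRankCW.BCubeBorderRank =
stmt-MatrixMultiplication-1852): the Kronecker cube of the small Coppersmith–Winograd tensor T_cw,2
lies in the closure of rank ≤ 63 tensors, bR(T_cw,2^{⊠3}) ≤ 63 < 64 (first strict
submultiplicativity of border rank for cw_2; window [45,64], square multiplicative = 16,
ConnerHuangLandsberg2020). Engine: format 27×27×27, r = 63, feasible only in the symmetric
sub-ansatz (patterns fixed by S_3 on Kronecker factors × Stab(T_cw,2)); success feeds
AsymptoticRankCW's X_B (R~(cw_2) = 3 ⇒ ω = 2). [deps: TwoSquaresThirteen] [difficulty: open-problem]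
(why it might fail: cubes are border-multiplicative for every q > 4
(ConnerGesmundoLandsbergVentura2022 Thm 1.2) and the q = 2 square is multiplicative (16); bR may be
64, and at 27³ even the symmetric pattern lattice may be too large to enumerate.)
[ConnerGesmundoLandsbergVentura2022, ConnerHuangLandsberg2020, AlmanLi2026, CoppersmithWinograd1990]
#9 SchonhageTightTwoTwo (support) — the smallest kissing cell, negative form (expected; cheapest
falsifier of KissingBeyondSchonhage at (2,2)): bR(⟨2,1,2⟩ ⊕ ⟨1,2,1⟩) ≥ 6, i.e. Schönhage's one free
scalar product is optimal for a 2×2 outer product (format 5×4×4; Koszul-blind; the order-2 pattern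
is excluded by hand in NOTES, higher orders open). Either sign closes it: a 5-term border scheme
refutes it and proves the rank-3 crux. [difficulty: M] [Schonhage1981, Blaser2013, arXiv:2205.05713,
BuczynskaBuczynski2021]
#9 TropicalBrentNecessary (support) — THE TROPICAL BRENT CONDITIONS (Kapranov's necessary condition,
the dictionary behind the enumerator; provable now): for an order-h approximate decomposition Σ_ρ
u_ρ⊗v_ρ⊗w_ρ = ε^h t + O(ε^{h+1}) over ℂ[ε] put val(ρ;a,b,c) = trailing degree of u_ρ(a) + of v_ρ(b)
+ of w_ρ(c) (⊤ if a factor is 0) and m = min_ρ val. Then at every cell (a,b,c): if m < h, or m = h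
and t_abc = 0, the minimum is attained by two distinct ρ; and t_abc ≠ 0 forces m ≤ h. (Proof: the
coefficient of ε^m is the single non-zero product of trailing coefficients if the minimum is
attained once.) [difficulty: provable-now] [doi:10.1090/gsm/161, Blaser2013,
doi:10.1515/crll.1987.375-376.406]
#9 ApproximationOrderBound (support) — EXHAUSTION IS A DECISION PROCEDURE (card S1;
Lehmkuhl–Lickteig 1989, TCS 69, 1–14, cited BCS §20.7 p.569: "explicit upper bounds on the order of
degenerations"): there is a function H of the format and r such that bR(t) ≤ r implies R_H(t) ≤ r
for every tensor t of format a×b×c over ℂ; hence "no pattern of order ≤ H(a,b,c,r)" proves bR(t) >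
r. (Abstract proof over ℂ in NOTES: {R_h ≤ r} constructible increasing in h with closed union σ̂_r
(Alder/Strassen, BCS Thm 20.3/20.24) ⇒ stabilises, by Baire + Noetherian induction; Lean-hard.)
[difficulty: XL] [doi:10.1007/978-3-662-03338-8, Blaser2013, Strassen1983]
#9 TwoByTwoSeven (support) — CALIBRATION OF EXHAUSTION MODE (card C3): bR(⟨2,2,2⟩) ≥ 7
(Landsberg2005; computer-assisted proof HauensteinIkenmeyerLandsberg2013; new proof
DolezalekMichalek2026) for the tree's algebraic border rank — tropically: no valuation pattern with
6 terms has a liftable initial system at any order; a certified enumeration would be a new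
kernel-checked proof, and 6 = 2n²−n is exactly where Koszul flattenings stop. [difficulty: L]
[Landsberg2005, HauensteinIkenmeyerLandsberg2013, DolezalekMichalek2026, LandsbergOttaviani2015]

TWO-LAYER PLAN. Foreseen glued splits (none filed now): TwoSquaresThirteen ⇐ PatternExists13 (a
valuation pattern of order ≤ 3 for (2⊙⟨2,2,2⟩, 13) with
consistent initial system over ℚ) → Lifts13 (it lifts to an `IsApproxDecomposition`) →
TwoSquaresThirteen; ThreeByThreeNineteen ⇐
SymmetricPattern19 (Z_3-fixed pattern with consistent initial system) → Lifts19 →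
ThreeByThreeNineteen; KissingBeyondSchonhage ⇐ one cell
(k,n) ∈ {(2,3),(3,3)} as an explicit `approxRank h … ≤ kn+1` → KissingBeyondSchonhage. Exhaustion
results are filed by tenure as
fixed-order statements `¬ (approxRank h T ≤ r)` with the census attached, never as edits of the
h-free cruxes.

KILL CRITERIA. ω(ℂ) > 2 from any refutation route refutes BorderCertificateFamily — close
`refuted:BorderCertificateFamily`. ω = 2 proved elsewhere
moots the route (target becomes a corollary; engine outputs survive as Literature identities).
TwoSquaresThirteen refuted (bR = 14),
SchonhageTightTwoTwo proved together with the (2,3),(3,3) kissing cells closed at kn+2, and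
ThreeByThreeNineteen refuted (bR = 20):
every cell in reach is negative — close `exhausted` with the pattern-count census unless a
parametric pattern has appeared. Symmetry-
reduced pattern counts > 10⁹ already for (2⊙⟨2,2,2⟩, 13, h ≤ 2) AND for the 5×4×4 kissing cell ⇒ the
enumerability premise is dead:
pivot cruxes to the symmetric sub-ansatz only, or close. CwCubeSixtyThree refuted (bR = 64) only
drops the shared client (route edit --drop).

NOT DECOMPOSED YET. The enumerator itself (E1 pattern lattice mod isotropy × S_r, E2 initial-system
solver over 𝔽_p/ℚ, E3 ε-adic lifting + exact
reconstruction, E4 the `IsApproxDecomposition` certificate by `decide`/`norm_num` over ℚ[X]) is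
software requested by provers via
kit, not items; fixed-order exhaustion statements `¬ approxRank h T ≤ r` (layer-2, filed when a run
reports); the symmetry-quotient
soundness lemma (torus/term rescalings act on Laurent patterns by lattice translations) and the
Laurent ↔ Bläser-order dictionary
(pole orders (α,β,γ) ↦ h = α+β+γ); the explicit Lehmkuhl–Lickteig H; the other clients of the card
(UT_2^{⊠2} ≤ 15, t_8^{⊠2} ≤ 95,
6-party bR of M_2⊗M_2 ≤ 48, T_{K_4}, M_2(ℂ[ε]/ε²)) which need structure-tensor definitions their own
cards must request first.

CHEAPEST FALSIFIER. (i) Lookup (lit search was down all session, rc 75 ×4 — the novelty auditor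
should run: "border rank ⟨k,1,n⟩ ⊕ ⟨1,m,1⟩ m > (k−1)(n−1)",
"Schönhage partial matrix multiplication optimal border rank", "minimal border rank 5×4×4
classification", "tropical border rank
approximate algorithm enumeration"): if bR(⟨k,1,n⟩ ⊕ ⟨1,(k−1)(n−1)+1,1⟩) = kn+2 is in print
(Schönhage 1981 §§4–6, Lickteig, BPR
arXiv:1902.06582 tables, JLP arXiv:2205.05713) the rank-3 crux dies at once. (ii) A border-apolarity
run (BuczynskaBuczynski2021) on the
5×4×4 kissing tensor at r = 5 — minutes. (iii) The symmetry-reduced pattern COUNT for (2⊙⟨2,2,2⟩, r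
= 13, h ≤ 2) before any solving.
Run here: Koszul flattenings (exact, mod p, generic restrictions, p ≤ 3): 2⊙⟨2,2,2⟩ → 12/11/11
(matches the card's floor); kissing
cells: +1 open, +2 dead for (2,2),(2,3),(3,3); hand row-space argument: no ORDER-2 pattern for the
(2,2) cell (NOTES) — the cell survives
only at higher order, which is weak evidence for SchonhageTightTwoTwo.

NUMBERS. bR(2⊙⟨2,2,2⟩) ∈ [12,14] (LandsbergOttaviani2015 via ⟨2,2,4⟩ ≤ 2⊙⟨2,2,2⟩;
Strassen⊕Strassen). bR(⟨3,3,3⟩) ∈ [17,20]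
(ConnerHarperLandsberg2023; Smirnov2013), 21 = BCS Ex. 15.8 (order 2). bR(⟨2,2,2⟩) = 7
(Landsberg2005). bR(T_cw,2^{⊠3}) ∈ [45,64],
square = 16 (ConnerGesmundoLandsbergVentura2022, ConnerHuangLandsberg2020). Schönhage (15.12):
bR(⟨e,1,ℓ⟩ ⊕ ⟨1,(e−1)(ℓ−1),1⟩) = eℓ+1,
order ≤_3 (h = 2 in Bläser's convention), ω < 2.55 at e = ℓ = 4 (13×13×17); CW82 (BCS Ex. 15.17) ω <
2.50; kissing ceilings by
flattening m ≤ kn+1−max(k,n); Koszul (this session): bR(⟨2,1,2⟩⊕⟨1,3,1⟩) ≥ 6, bR(⟨2,1,3⟩⊕⟨1,4,1⟩) ≥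
8, bR(⟨3,1,3⟩⊕⟨1,6,1⟩) ≥ 11, and
only ≥ 5, 7, 10 at m = (k−1)(n−1)+1. Cell values: (2,2,+1): τ = 0.842 → ω ≤ 2.53; 2⊙⟨2,2,2⟩ = 13: ω
≤ 2.70; ⟨3,3,3⟩ = 19: ω ≤ 2.68.
Orders of the identities in print (Bläser h): Bini 1, Schönhage 2, BCS Ex 15.8 2, CW_q 3. Items at
open: 10 (1 target, 4 cruxes,
4 support, 1 assembly).

DEFINITION REQUESTS. D1 (to be filed after open, topic
Literature/Computability/AlgebraicComplexity): `IsTropicalBrentPattern (h : ℕ) (t : ι → κ → μ → K)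
(W : Fin r → (ι → ℕ∞) × (κ → ℕ∞) × (μ → ℕ∞)) : Prop` — the conditions of TropicalBrentNecessary on
an abstract valuation pattern W
(the tropical Brent prevariety P_h(t,r) as a predicate), so that exhaustion statements and the
symmetry-quotient lemma stop inlining
trailing degrees. Cite facts wanted: LehmkuhlLickteig1989 explicit order bound (named fact,
discharges ApproximationOrderBound);
Alder 1984 / BCS Thm 20.3 (algebraic = topological border rank over ℂ), which also makes
CwCubeSixtyThree and its algBorderRank form
interchangeable. Bib entries prepared in the folder (bib/one_*.bib: BurgisserClausenShokrollahi1997,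
Bini1980,
BiniCapovaniRomaniLotti1979, Strassen1987, LehmkuhlLickteig1989, MaclaganSturmfels2015, Draisma2008,
BuczynskiPostinghelRupniewski2019,
JelisiejewLandsbergPal2022) — `ledger bib add` timed out on an overloaded gate; DOIs/arXiv ids are
used inline meanwhile.

Novelty: Searches (2026-08-15): `lit search` ×4 (hybrid/local/remote: "Lehmkuhl Lickteig order of
approximation", "border rank Schönhage partial
matrix multiplication direct sum scalar products kn+1 optimal", "tropical geometry border rank
approximate bilinear algorithm valuation",
all rc 75 — searchd unavailable all session, to be re-run by the auditor); `lit galaxy search --star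
all` ×7 ("border rank partial matrix
multiplication Schönhage", "tropical secant variety border rank tensor", "approximate bilinear
algorithm degeneration order", "tropical
Brent", "Bini pattern", "approximative triadic decompositions", "partial matrix multiplication": 0
relevant rows; 2 pdf hits on border
depth-3 circuits / variety extractors, off-topic); full-text greps of the materialised BCS 1997
(doi:10.1007/978-3-662-03338-8: (15.11),
(15.12) p.415/422, Def 15.19, Lemma 15.24, Ex. 15.8/15.16/15.17, §20.6 Thm 20.24, §20.7 Notes p.569
on Lehmkuhl–Lickteig) and of Bläser
2013 (doi:10.4086/toc.gs.2013.005 §7 Lemma 7.1, pp.29–30: no optimality claim for m = (k−1)(n−1));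
the 24 route files of the
sub-problem (grep tropical|prevariety|valuation pattern|Bini pattern: none) and the 76 open + 10
closed idea cards (only
hensel-rees-obstruction-calculus uses valuations, p-adically); `ledger negatives` (0). The card's
own novelty was audited today
(refuter-novelty-audit-13-0: new-combination; page-checked nearest prior art: Strassen 1987
combinatorial degenerations = BCS Def
15.29–15.30 p.426; Maclagan–Sturmfels; C  [refs: 10.1007/978-3-662-03338-8:, 10.4086/toc.gs.2013.005, 10.1515/crll.1987.375-376.406, 10.1016/j.jpaa.2007.05.022, doi:10.1007/978-3-662-03338-8, doi:10.4086/toc.gs.2013.005, doi:10.1515/crll.1987.375-376.406, doi:10.1016/j.jpaa.2007.05.022, Schonhage1981, Smirnov2013, ConnerGesmundoLandsbergVentura2022, Blaser2013]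

Barriers (technique_class: single-basic-algorithm, computation, tropical-enumeration): - technique_class: single-basic-algorithm, computation, tropical-enumeration
- Literature.Barriers.MatrixMultiplication.InfimumNotMinimumBarrier: it does not evade it and does
not need to — CW82 strict ASI (`CoppersmithWinograd1982_strictASI`, proved half
`sum_rpow_two_thirds_lt_algBorderRank_matMulDirectSum`) says every single certificate of X has 3τ >
2, so each finite crux certifies only ω < 3τ (2.53 / 2.70 / 2.68 for the three cells); X quantifies
over an infinite family (∀ε), which the barrier permits; the bet is that enumerated patterns
generalise to parametric families as Schönhage's and CW's did.
- Literature.Barriers.MatrixMultiplication.LinearRankMethodBarrier: not this class for the cruxes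
(upper bounds); the lower-bound support items (SchonhageTightTwoTwo at 6 on a 5×4×4 format,
TwoByTwoSeven at 7 on 4×4×4) sit far below the rank-method caps (8m / cactus 2(3m−2)), and 7 for
⟨2,2,2⟩ is known not to be a flattening bound — their intended proofs (tropical exhaustion, border
apolarity, minimal-border-rank rigidity) are not rank methods.
- Literature.Barriers.MatrixMultiplication.UniversalMethodBarrier: applies only to the shared client
CwCubeSixtyThree as in route AsymptoticRankCW (powers of the fixed intermediate tensor cw_2, ω_u
bound 2.17); the direct-sum certificates of X power no intermediate tensor (ASI on matrix products
themselves), so the barrier's number is not in force — InfimumNotMinimum replaces it.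
- Literature.Barriers.MatrixMultiplication.Irreversibili

History (route lifecycle, newest last):
- 2026-08-16T04:11:33Z · AUTO-CRUX (backfill): BorderCertificateFamily — hypotheses of the deciding theorem that nothing in the route derives are cruxes (operator:999:1085951)
- 2026-08-23T11:32:11Z · DORMANT — reconciler: no traction for 6.1 d (last activity statement-grounded at 2026-08-17T08:42:09Z); parked, not closed — `ledger route dormant route-MatrixMultiplicat (operator:999:165501)

sub-problem: MatrixMultiplication · status: dormant · opened planner-plancard-MatrixMultiplication-MatrixM-853e51d2-0 2026-08-15T12:22:23Z · rev 1 · ledger route-MatrixMultiplication-TropicalBiniPatterns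
GENERATED by the gate from the ledger (D-0016/17). Provers cite these decls: `theorem foo : Summit.MatrixMultiplication.MatrixMultiplication.Theses.TropicalBiniPatterns.<Decl> := …` in Summits/MatrixMultiplication/MatrixMultiplication/Theorems/<Name>.lean.
-/

namespace Summit.MatrixMultiplication.MatrixMultiplication.Theses.TropicalBiniPatterns

open scoped BigOperators Topology Manifold Classical MeasureTheory ProbabilityTheory Matrix InnerProductSpace ComplexConjugate ContinuousMap
open Filter Set Function TopologicalSpace MeasureTheory

attribute [summit_statement] _root_.MatrixMultiplication

/-- item stmt-MatrixMultiplication-8005 · crux (kind.auto-crux: conjecture-grade) · rank 0 · open · by planner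
why it might fail: Equivalent to ω(ℂ)=2, so false if any refutation line (BorderRankLowerBound, BrentRefutationDepth, FidelityWitnesses) succeeds; and by CW82 strict ASI no single certificate reaches τ = 2/3, so an INFINITE parametric family of patterns is needed and none beyond laser-type degenerations is known.
sources: Schonhage1981, Blaser2013, CoppersmithWinograd1982, doi:10.1007/978-3-662-03338-8
[target] X as in § Thesis: ∀ε>0 ∃ p ≥ 1, blocks ⟨k_i,m_i,n_i⟩ (all k_i m_i n_i ≥ 2) and r with
bR(⊕_i ⟨k_i,m_i,n_i⟩) ≤ r ≤ Σ_i (k_i m_i n_i)^{(2+ε)/3} over ℂ. -/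
@[route_item "route-MatrixMultiplication-TropicalBiniPatterns", crux]
def BorderCertificateFamily : Prop :=
  ∀ ε : ℝ, 0 < ε → ∃ (p : ℕ) (k m n : Fin p → ℕ) (r : ℕ), 0 < p ∧ (∀ i, 2 ≤ k i * m i * n i) ∧ Literature.Computability.AlgebraicComplexity.algBorderRank (Literature.Computability.AlgebraicComplexity.matMulDirectSum ℂ k m n) ≤ r ∧ (r : ℝ) ≤ ∑ i, ((k i * m i * n i : ℕ) : ℝ) ^ ((2 + ε) / 3)

/-- item stmt-MatrixMultiplication-8006 · crux · rank 2 · open · by planner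
why it might fail: bR is probably 14 (border additivity for two identical ⟨2,2,2⟩ blocks; ALS at r = 13 finds only the drop-one-term plateau, card independent-products-amortised-rank); Schönhage-type savings use unequal rectangular shapes; and a 13 might need pole order beyond the enumerable range.
sources: Schonhage1981, LandsbergOttaviani2015, arXiv:1902.06582, arXiv:1504.03732, CoppersmithWinograd1982, Landsberg2005
[crux] bR(⟨2,2,2⟩ ⊕ ⟨2,2,2⟩) ≤ 13 over ℂ[ε] (card C1, the auditor's "right first run"; format 8×8×8,
r = 13): two independent 2×2 products share a border saving. Window [12,14]: 14 = Strassen ⊕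
Strassen, 12 = Koszul flattening via the module restriction ⟨2,2,4⟩ ≤ 2⊙⟨2,2,2⟩
(LandsbergOttaviani2015 Cor 1.2; recomputed this session: p=1 gives 12, p=2,3 give 11). An
X-instance with ε = 0.70 (2·8^τ = 13, ω ≤ 2.70) and the smallest cell of border (non-)additivity for
identical matrix-product blocks (card independent-products-amortised-rank Q_b). Engine: patterns of
order h ≤ 3 modulo (G_{M_2}² ⋊ S_2)-isotropy lattice × S_13. [difficulty: L] -/
@[route_item "route-MatrixMultiplication-TropicalBiniPatterns"]
def TwoSquaresThirteen : Prop :=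
  Literature.Computability.AlgebraicComplexity.algBorderRank (Literature.Computability.AlgebraicComplexity.matMulDirectSum ℂ ![2, 2] ![2, 2] ![2, 2]) ≤ 13

/-- item stmt-MatrixMultiplication-8007 · crux · rank 3 · open · by planner
why it might fail: (k−1)(n−1) may be optimal for every (k,n): at (2,2) the lowest-order pattern (identity block at ε²) is already impossible by a row-space argument (NOTES), and minimal-border-rank rigidity (Strassen's equations, arXiv:2205.05713) may give a uniform kn+2 lower bound.
sources: Schonhage1981, doi:10.1007/978-3-662-03338-8, Blaser2013, LandsbergOttaviani2015, arXiv:2205.05713, arXiv:1902.06582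
[crux] KISSING BEYOND SCHÖNHAGE: for some k, n ≥ 2 one more free scalar product fits, bR(⟨k,1,n⟩ ⊕
⟨1,(k−1)(n−1)+1,1⟩) ≤ kn + 1 (then = kn+1 by conciseness). Schönhage's (15.12) gives m = (k−1)(n−1)
at order ≤_3; the flattening ceiling is m ≤ kn + 1 − max(k,n); Koszul flattenings (p ≤ 3, generic
restriction, this session: compute/koszul_kiss.py) kill m = (k−1)(n−1)+2 and are BLIND at +1 for
(k,n) ∈ {(2,2),(2,3),(3,3)} — cells 5×4×4 r=5, 7×5×6 r=7, 10×8×8 r=10, the engine's native family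
and cheapest virgin territory (Schönhage found his pattern by hand). Each positive cell is a new
X-instance ((2,2): 4^τ + 2^τ = 5, τ = 0.842, ω ≤ 2.53 from a 5×4×4 tensor); a parametric positive
answer is a new certificate FAMILY. [difficulty: M] -/
@[route_item "route-MatrixMultiplication-TropicalBiniPatterns"]
def KissingBeyondSchonhage : Prop :=
  ∃ k n : ℕ, 2 ≤ k ∧ 2 ≤ n ∧ Literature.Computability.AlgebraicComplexity.algBorderRank (Literature.Computability.AlgebraicComplexity.matMulDirectSum ℂ ![k, 1] ![1, (k - 1) * (n - 1) + 1] ![n, 1]) ≤ k * n + 1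

/-- item stmt-MatrixMultiplication-8008 · crux · rank 4 · open · by planner
why it might fail: bR(⟨3,3,3⟩) may be 20: a decade of numerical searches (Smirnov) found 20 repeatedly and never 19; border apolarity may climb from 17; and a 19 of order > 2 or with trivial stabiliser is invisible to the restricted enumeration.
sources: Smirnov2013, ConnerHarperLandsberg2023, doi:10.1007/978-3-662-03338-8, LandsbergMichalek2018, BuczynskaBuczynski2021
[crux] bR(⟨3,3,3⟩) ≤ 19 over ℂ[ε] (card C2; format 9×9×9). Window [17,20]: 17 by border apolarity
(ConnerHarperLandsberg2023), 20 by Smirnov2013 (numerical then exact), 21 = Schönhage's order-2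
pattern (BCS Ex. 15.8). Engine: patterns of order h ≤ 2 with a stabiliser of order ≥ 3 in (S_3 ≀
transpose/cyclic) × torus — the border analogue of the symmetric-scheme searches; a 19 reads ω ≤
log_27 19³ = 2.68 and is the first movement at 3×3 since 2013. [deps: TwoSquaresThirteen]
[difficulty: open-problem] -/
@[route_item "route-MatrixMultiplication-TropicalBiniPatterns"]
def ThreeByThreeNineteen : Prop :=
  Literature.Computability.AlgebraicComplexity.algBorderRank (Literature.Computability.AlgebraicComplexity.matMulTensor ℂ 3 3 3) ≤ 19

/-- item stmt-MatrixMultiplication-1852 · crux · rank 5 · open · by planner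
why it might fail: cubes are border-multiplicative for every q > 4 (ConnerGesmundoLandsbergVentura2022 Thm 1.2) and the q = 2 square is multiplicative (16); bR may be 64, and at 27³ even the symmetric pattern lattice may be too large to enumerate.
sources: ConnerGesmundoLandsbergVentura2022, ConnerHuangLandsberg2020, AlmanLi2026, CoppersmithWinograd1990
[crux] First strict submultiplicativity of BORDER rank for the small CW tensor, at the cube:
bR(T_cw,2^{⊠3}) ≤ 63 < 64 = bR(T_cw,2)^3. Stated topologically — T_cw,2^{⊠3} = kroneckerPow
(cwTensor-inline) 3 ∈ (ℂ^27)^{⊗3}, written on (Fin 3 → Fin 3)^3, lies in the Euclidean closure of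
the tensors of rank ≤ 63 — because the route file imports only
MatrixMultiplicationExponent/AsymptoticSpectrum (no algBorderRank/cwTensor; the inline tensor is
rfl-equal to cwTensor ℂ 2). Over ℂ this is equivalent to algBorderRank ≤ 63 (SchoenhageTau.lean):
ℂ[ε]-families give limits, and secant varieties have equal Zariski/Euclidean closures;
Koszul-flattening lower bounds transfer directly by lower semicontinuity of matrix rank. Known: 45 =
15·3 ≤ bR (ConnerGesmundoLandsbergVentura2022 = arXiv:1909.04785 Thm 1.2, q = 2 cube clause, PROVED
in tree as CGLV2022_thm12_holds.cube from the certified p = 2 Koszul rank 265) and bR ≤ 4^3 = 64;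
the square is multiplicative, bR(T_cw,2^{⊠2}) = bR(perm_3) = 16 (ConnerHuangLandsberg2020 =
arXiv:2009.11391 Thm 1.1, 'bad news'); cubes ARE multiplicative for every q > 4 (CGLV Thm 1.2;
Kawabe arXiv:2507.13126 Thm 4.1 reproves q ≥ 5), nothing beyond the Koszul bounds is k -/
@[route_item "route-MatrixMultiplication-TropicalBiniPatterns"]
def CwCubeSixtyThree : Prop :=
  Literature.Computability.AlgebraicComplexity.kroneckerPow (fun i j k : Fin 3 => if (i = 0 ∧ j = k ∧ j ≠ 0) ∨ (j = 0 ∧ i = k ∧ i ≠ 0) ∨ (k = 0 ∧ i = j ∧ i ≠ 0) then (1 : ℂ) else 0) 3 ∈ closure {s : (Fin 3 → Fin 3) → (Fin 3 → Fin 3) → (Fin 3 → Fin 3) → ℂ | Literature.Computability.AlgebraicComplexity.tensorRank s ≤ 63}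

/-- item stmt-MatrixMultiplication-8009 · support · rank 9 · closed · proved by Summit.MatrixMultiplication.MatrixMultiplication.Theorems.schonhageTightTwoTwo_proof @ a9434ad31991 (prover) · by planner
sources: Schonhage1981, Blaser2013, arXiv:2205.05713, BuczynskaBuczynski2021
[support] the smallest kissing cell, negative form (expected; cheapest falsifier of
KissingBeyondSchonhage at (2,2)): bR(⟨2,1,2⟩ ⊕ ⟨1,2,1⟩) ≥ 6, i.e. Schönhage's one free scalar
product is optimal for a 2×2 outer product (format 5×4×4; Koszul-blind; the order-2 pattern is
excluded by hand in NOTES, higher orders open). Either sign closes it: a 5-term border scheme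
refutes it and proves the rank-3 crux. [difficulty: M] -/
@[route_item "route-MatrixMultiplication-TropicalBiniPatterns"]
def SchonhageTightTwoTwo : Prop :=
  6 ≤ Literature.Computability.AlgebraicComplexity.algBorderRank (Literature.Computability.AlgebraicComplexity.matMulDirectSum ℂ ![2, 1] ![1, 2] ![2, 1])

/-- item stmt-MatrixMultiplication-8010 · support · rank 9 · closed · proved by Summit.MatrixMultiplication.MatrixMultiplication.Theorems.tropicalBrentNecessary_proof @ 0d3644d1b193 (prover) · by planner
sources: doi:10.1090/gsm/161, Blaser2013, doi:10.1515/crll.1987.375-376.406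
[support] THE TROPICAL BRENT CONDITIONS (Kapranov's necessary condition, the dictionary behind the
enumerator; provable now): for an order-h approximate decomposition Σ_ρ u_ρ⊗v_ρ⊗w_ρ = ε^h t +
O(ε^{h+1}) over ℂ[ε] put val(ρ;a,b,c) = trailing degree of u_ρ(a) + of v_ρ(b) + of w_ρ(c) (⊤ if a
factor is 0) and m = min_ρ val. Then at every cell (a,b,c): if m < h, or m = h and t_abc = 0, the
minimum is attained by two distinct ρ; and t_abc ≠ 0 forces m ≤ h. (Proof: the coefficient of ε^m is
the single non-zero product of trailing coefficients if the minimum is attained once.) [difficulty: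
provable-now] -/
@[route_item "route-MatrixMultiplication-TropicalBiniPatterns"]
def TropicalBrentNecessary : Prop :=
  ∀ (ι κ μ : Type) [Fintype ι] [Fintype κ] [Fintype μ] (h r : ℕ) (t : ι → κ → μ → ℂ) (u : Fin r → ι → Polynomial ℂ) (v : Fin r → κ → Polynomial ℂ) (w : Fin r → μ → Polynomial ℂ), Literature.Computability.AlgebraicComplexity.IsApproxDecomposition h t u v w → ∀ (a : ι) (b : κ) (c : μ), let val : Fin r → ℕ∞ := fun ρ => (u ρ a).trailingDegree + (v ρ b).trailingDegree + (w ρ c).trailingDegree; ((Finset.univ.inf val < (h : ℕ∞) ∨ (Finset.univ.inf val = (h : ℕ∞) ∧ t a b c = 0)) → ∃ ρ₁ ρ₂ : Fin r, ρ₁ ≠ ρ₂ ∧ val ρ₁ = Finset.univ.inf val ∧ val ρ₂ = Finset.univ.inf val) ∧ (t a b c ≠ 0 → Finset.univ.inf val ≤ (h : ℕ∞))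

/-- item stmt-MatrixMultiplication-8011 · support · rank 9 · closed · proved by Summit.MatrixMultiplication.MatrixMultiplication.Theorems.approximationOrderBound_proof @ 3c3867751c78 (prover) · by planner
sources: doi:10.1007/978-3-662-03338-8, Blaser2013, Strassen1983
[support] EXHAUSTION IS A DECISION PROCEDURE (card S1; Lehmkuhl–Lickteig 1989, TCS 69, 1–14, cited
BCS §20.7 p.569: "explicit upper bounds on the order of degenerations"): there is a function H of
the format and r such that bR(t) ≤ r implies R_H(t) ≤ r for every tensor t of format a×b×c over ℂ;
hence "no pattern of order ≤ H(a,b,c,r)" proves bR(t) > r. (Abstract proof over ℂ in NOTES: {R_h ≤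
r} constructible increasing in h with closed union σ̂_r (Alder/Strassen, BCS Thm 20.3/20.24) ⇒
stabilises, by Baire + Noetherian induction; Lean-hard.) [difficulty: XL] -/
@[route_item "route-MatrixMultiplication-TropicalBiniPatterns"]
def ApproximationOrderBound : Prop :=
  ∃ H : ℕ → ℕ → ℕ → ℕ → ℕ, ∀ (a b c r : ℕ) (t : Fin a → Fin b → Fin c → ℂ), Literature.Computability.AlgebraicComplexity.algBorderRank t ≤ r → Literature.Computability.AlgebraicComplexity.approxRank (H a b c r) t ≤ r

/-- item stmt-MatrixMultiplication-8012 · support · rank 9 · closed · proved by Summit.MatrixMultiplication.MatrixMultiplication.Theorems.twoByTwoSeven_proof @ d59b5b778e08 (prover) · by planner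
sources: Landsberg2005, HauensteinIkenmeyerLandsberg2013, DolezalekMichalek2026, LandsbergOttaviani2015
[support] CALIBRATION OF EXHAUSTION MODE (card C3): bR(⟨2,2,2⟩) ≥ 7 (Landsberg2005;
computer-assisted proof HauensteinIkenmeyerLandsberg2013; new proof DolezalekMichalek2026) for the
tree's algebraic border rank — tropically: no valuation pattern with 6 terms has a liftable initial
system at any order; a certified enumeration would be a new kernel-checked proof, and 6 = 2n²−n is
exactly where Koszul flattenings stop. [difficulty: L] -/
@[route_item "route-MatrixMultiplication-TropicalBiniPatterns"]
def TwoByTwoSeven : Prop :=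
  7 ≤ Literature.Computability.AlgebraicComplexity.algBorderRank (Literature.Computability.AlgebraicComplexity.matMulTensor ℂ 2 2 2)

/-- item stmt-MatrixMultiplication-8013 · assembly · rank 1 · closed · proved by Summit.MatrixMultiplication.MatrixMultiplication.Theorems.tropicalBiniPatterns_assembly_proof @ 40872d426210 (prover) · by planner
sources: Schonhage1981, Blaser2013
[assembly] BorderCertificateFamily → MatrixMultiplication (ω(ℂ) = 2), via the proved border-rank
asymptotic sum inequality and ω ≥ 2. -/
@[route_item "route-MatrixMultiplication-TropicalBiniPatterns"]
def Assembly : Prop :=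
  BorderCertificateFamily → MatrixMultiplication

/-! D-0027 §2.1 — DECIDING THEOREM (planner-authored via `route open/edit --closes-file`; by planner-rbadge-MatrixMultiplication-TropicalBi-ea6b4ad3-g2-0 2026-08-15T16:20:02Z):
its hypotheses are this route's items and its conclusion the sub-problem Statement (glue_lint), and it elaborates with this file. -/

/-- DECIDING THEOREM (D-0027 §2.1): the target `BorderCertificateFamily` (X = the Schönhage border-certificate
family: for every `ε > 0` a direct sum `D = ⊕_{i<p} ⟨kᵢ,mᵢ,nᵢ⟩`, `p ≥ 1`, all `kᵢmᵢnᵢ ≥ 2`, with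
`bR(D) ≤ r ≤ ∑ᵢ (kᵢmᵢnᵢ)^{(2+ε)/3}`) ALONE decides `ω(ℂ) = 2`, through PROVED Literature only — no other
item is assumed. Schönhage's asymptotic sum inequality for the border rank,
`asymptoticSumInequality_algBorderRank` (SchoenhageTauDischarge.lean, a theorem: `bR(⊕ᵢ⟨kᵢ,mᵢ,nᵢ⟩) ≤ r →
∑ᵢ (kᵢmᵢnᵢ)^{ω/3} ≤ r`), gives `∑ᵢ (kᵢmᵢnᵢ)^{ω/3} ≤ r ≤ ∑ᵢ (kᵢmᵢnᵢ)^{(2+ε)/3}`; if `ω > 2 + ε` every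
summand on the right is strictly smaller than the one on the left (`kᵢmᵢnᵢ ≥ 2 > 1`,
`Real.rpow_lt_rpow_of_exponent_lt`) and the index set `Fin p` is non-empty (`p ≥ 1`,
`Finset.sum_lt_sum_of_nonempty`) — contradiction; so `ω ≤ 2 + ε` for every `ε > 0`, i.e. `ω ≤ 2`
(`le_of_forall_pos_le_add`), and the flattening lower frame `omega_two_le ℂ : 2 ≤ ω(ℂ)`
(FlatteningBound.lean) closes. -/
@[closes "route-MatrixMultiplication-TropicalBiniPatterns"] theorem closes (hX : BorderCertificateFamily) : MatrixMultiplication := by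
  show Literature.Computability.AlgebraicComplexity.omega ℂ = 2
  refine le_antisymm ?_ (Literature.Computability.AlgebraicComplexity.omega_two_le ℂ)
  refine le_of_forall_pos_le_add fun ε hε => ?_
  obtain ⟨p, k, m, n, r, hp, hkmn, hR, hr⟩ := hX ε hε
  have hASI :=
    Literature.Computability.AlgebraicComplexity.asymptoticSumInequality_algBorderRank ℂ k m n hR
  by_contra hlt
  rw [not_le] at hlt
  have hne : (Finset.univ : Finset (Fin p)).Nonempty := ⟨⟨0, hp⟩, Finset.mem_univ _⟩
  have hsum : ∑ i, ((k i * m i * n i : ℕ) : ℝ) ^ ((2 + ε) / 3) <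
      ∑ i, ((k i * m i * n i : ℕ) : ℝ) ^ (Literature.Computability.AlgebraicComplexity.omega ℂ / 3) :=
    Finset.sum_lt_sum_of_nonempty hne fun i _ =>
      Real.rpow_lt_rpow_of_exponent_lt (by exact_mod_cast (hkmn i : 1 < k i * m i * n i))
        (by linarith)
  linarith

end Summit.MatrixMultiplication.MatrixMultiplication.Theses.TropicalBiniPatterns
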